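import Literature.AlgebraicGeometry.Modules.SerreTwistCechComplex
import HarnessLib

/-!
# Serre's vanishing theorem `Ȟ¹(𝒰; G(n)) = 0`, `n ≫ 0`, for the twists of a coherent module on `Z ⊆ 𝐏ʳ_A`

Conclusion of `Modules/SerreTwistCechComplex`: the tree's Čech `H¹` of a sheaf of modules
(`Morphisms/CechModule`: all ordered pairs, `CechMH1 f M U`) maps injectively to `H¹` of the alternating
complex `SerreTwist.cechZM` (module form of `ProjCech.compH1_injective`, Stacks Project Tags 01FG/01FM in
degree one: a cocycle has `c_{ii} = 0`, `c_{ij} = -c_{ji}`), so Serre's vanishing theorem for the latter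
(`SerreTwist.exists_forall_isZero_homology_cechZM`) gives

* `SerreTwist.exists_forall_subsingleton_cechMH1_twistMod` — **for a closed subscheme `ι : Z ↪ 𝐏ʳ_A` over a
  Noetherian ring `A`, an affine-localizing `𝒪_Z`-module `G` and generators `g : J → Γ(Z, G(m₀))` as in
  Serre's theorem A, there is `d₀` with `Ȟ¹(𝒰; G(n)) = 0` for all `n ≥ d₀`**, `𝒰 = (Z ∩ D₊(x_i))_i`
  (Hartshorne III Thm. 5.2 (b) for `i = 1`, with cohomology computed by the Čech complex of the standard
  affine cover, III Thm. 4.5).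

The general-`M` part (`edgeValM`, `vertexValM`, `cocycle_diagM`, …) is the module version of the
corresponding section of `Morphisms/CechH1ProjectiveFinite`. Everything is proved; no named facts.

References: Hartshorne III Thm. 4.5, Thm. 5.2 (b) (p. 228); Stacks Project, Tags 01FG, 01FM, 01XD.
[Hartshorne1977]
-/

noncomputable section

universe u

open CategoryTheory CategoryTheory.Limits AlgebraicGeometry TopologicalSpace Opposite
open Literature.Algebra.Homology Literature.Algebra.Homology.LaurentCech Literature.Algebra.Homology.OrderedCech
open Literature.AlgebraicGeometry.Morphisms Literature.AlgebraicGeometry.Morphisms.ProjCech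

attribute [local instance] MvPolynomial.gradedAlgebra
  Literature.AlgebraicGeometry.Motives.ProjBaseChange.algebraBase

namespace Literature.AlgebraicGeometry.Modules

namespace SerreTwist

variable {A : Type u} [CommRing A] {r : ℕ} {Z : Scheme.{u}} (ι : Z ⟶ PP A r) (M : Z.Modules)

/-! ## `dQM` on edges and triangles -/

/-- Restricting the values of a cochain at equal simplices gives the same section. [folklore] -/
theorem resM_apply_eq_of_eq {p : ℤ} (q : QXM ι M p) {E E' : Simplex (Fin (r + 1)) p} (e : E = E')
    {V : Z.Opens} (h : V ≤ Zop ι E.1) (h' : V ≤ Zop ι E'.1) :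
    MSections.res (strZ ι) M h (q E) = MSections.res (strZ ι) M h' (q E') := by
  subst e; rfl

/-- `faceQM` at a face identified with a given simplex `E`. [folklore] -/
theorem faceQM_eq {p : ℤ} (τ : Simplex (Fin (r + 1)) (p + 1)) (x : Fin (r + 1)) (E : Simplex (Fin (r + 1)) p)
    (hE : τ.1.erase x = E.1) (hle : Zop ι τ.1 ≤ Zop ι E.1) (q : QXM ι M p) :
    faceQM ι M p τ x q = MSections.res (strZ ι) M hle (q E) := by
  have h : (τ.1.erase x).Nonempty ∧ ((τ.1.erase x).card : ℤ) = p + 1 := by rw [hE]; exact E.2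
  rw [faceQM_apply_of ι M τ x h]
  exact resM_apply_eq_of_eq ι M q (E := ⟨τ.1.erase x, h⟩) (E' := E) (Subtype.ext hE) _ _

/-- **`dQM` on an edge**: `(d g)_{a<b} = g_b|_{Z_{ab}} - g_a|_{Z_{ab}}`. [folklore] -/
theorem dQM_edge (g : QXM ι M 0) (a b : Fin (r + 1)) (hab : a < b) :
    dQM ι M 0 g (edge a b hab) =
      MSections.res (strZ ι) M (Zop_mono ι (by simp)) (g (vertex b)) -
        MSections.res (strZ ι) M (Zop_mono ι (by simp)) (g (vertex a)) := by
  rw [dQM_apply]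
  change ∑ x ∈ ({a, b} : Finset (Fin (r + 1))), sign A {a, b} x • faceQM ι M 0 (edge a b hab) x g = _
  rw [Finset.sum_pair hab.ne]
  have h1 : ({a, b} : Finset (Fin (r + 1))).erase a = (vertex b).1 := by
    rw [vertex_val, Finset.erase_insert]; simp [hab.ne]
  have h2 : ({a, b} : Finset (Fin (r + 1))).erase b = (vertex a).1 := by
    rw [vertex_val, Finset.pair_comm, Finset.erase_insert]; simp [hab.ne']
  have s1 : sign A ({a, b} : Finset (Fin (r + 1))) a = 1 := by
    rw [sign, show ({a, b} : Finset (Fin (r + 1))).filter (· < a) = ∅ by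
      ext i; simp only [Finset.mem_filter, Finset.mem_insert, Finset.mem_singleton, Finset.notMem_empty,
        iff_false, not_and]
      rintro (rfl | rfl)
      · exact lt_irrefl _
      · exact lt_asymm hab]
    simp
  have s2 : sign A ({a, b} : Finset (Fin (r + 1))) b = -1 := by
    rw [sign, show ({a, b} : Finset (Fin (r + 1))).filter (· < b) = {a} by
      ext i; simp only [Finset.mem_filter, Finset.mem_insert, Finset.mem_singleton]
      constructor
      · rintro ⟨rfl | rfl, h⟩
        · rfl
        · exact absurd h (lt_irrefl _)
      · rintro rfl; exact ⟨Or.inl rfl, hab⟩]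
    simp
  rw [faceQM_eq ι M (edge a b hab) a (vertex b) h1 (Zop_mono ι (by simp)),
    faceQM_eq ι M (edge a b hab) b (vertex a) h2 (Zop_mono ι (by simp)), s1, s2, one_smul, neg_one_smul, sub_eq_add_neg]

/-- **`dQM` on a triangle**: `(d c)_{a<b<e} = c_{be} - c_{ae} + c_{ab}` (restricted to `Z_{abe}`). [folklore] -/
theorem dQM_triangle (c : QXM ι M 1) (a b e : Fin (r + 1)) (hab : a < b) (hbe : b < e) :
    dQM ι M 1 c (triangle a b e hab hbe) =
      MSections.res (strZ ι) M (Zop_mono ι (by simp [triangle, Finset.subset_iff])) (c (edge b e hbe)) -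
        MSections.res (strZ ι) M (Zop_mono ι (by simp [triangle, Finset.subset_iff])) (c (edge a e (hab.trans hbe))) +
          MSections.res (strZ ι) M (Zop_mono ι (by simp [triangle, Finset.subset_iff])) (c (edge a b hab)) := by
  rw [dQM_apply]
  change ∑ x ∈ ({a, b, e} : Finset (Fin (r + 1))), sign A {a, b, e} x • faceQM ι M 1 (triangle a b e hab hbe) x c = _
  have hnot : a ∉ ({b, e} : Finset (Fin (r + 1))) := by
    simp only [Finset.mem_insert, Finset.mem_singleton, not_or]; exact ⟨hab.ne, (hab.trans hbe).ne⟩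
  rw [Finset.sum_insert hnot, Finset.sum_pair hbe.ne, sign_triangle_left hab hbe, sign_triangle_mid hab hbe,
    sign_triangle_right hab hbe,
    faceQM_eq ι M (triangle a b e hab hbe) a (edge b e hbe) (triangle_erase_left hab hbe)
      (Zop_mono ι (by simp [triangle, Finset.subset_iff])),
    faceQM_eq ι M (triangle a b e hab hbe) b (edge a e (hab.trans hbe)) (triangle_erase_mid hab hbe)
      (Zop_mono ι (by simp [triangle, Finset.subset_iff])),
    faceQM_eq ι M (triangle a b e hab hbe) e (edge a b hab) (triangle_erase_right hab hbe)
      (Zop_mono ι (by simp [triangle, Finset.subset_iff]))]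
  rw [one_smul, neg_one_smul, one_smul]
  abel

/-! ## From Čech cocycles of the tree (`CechMH1`) to cocycles of `cechZM` -/

/-- The value `c_{lo σ, hi σ}|_{Z_σ}` of a Čech `1`-cochain of the tree on the edge `σ`, a linear map.
[folklore] -/
def edgeValM : CechMC1 (strZ ι) M (cover ι) →ₗ[A] QXM ι M 1 :=
  LinearMap.pi fun σ => MSections.res (strZ ι) M (Zop_le_cover_inf ι σ) ∘ₗ
    (LinearMap.proj (hi σ) ∘ₗ LinearMap.proj (R := A)
      (φ := fun i => ∀ j, MSections (strZ ι) M (cover ι i ⊓ cover ι j)) (lo σ))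

/-- `edgeValM` unfolded. [folklore] -/
theorem edgeValM_apply (c : CechMC1 (strZ ι) M (cover ι)) (σ : Simplex (Fin (r + 1)) 1) :
    edgeValM ι M c σ = MSections.res (strZ ι) M (Zop_le_cover_inf ι σ) (c (lo σ) (hi σ)) := rfl

/-- Transport of `edgeValM` along the identification of the vertices of an edge. [folklore] -/
theorem res_edgeValM_edge (c : CechMC1 (strZ ι) M (cover ι)) (a b : Fin (r + 1)) (hab : a < b) {V : Z.Opens}
    (h : V ≤ Zop ι (edge a b hab).1) :
    MSections.res (strZ ι) M h (edgeValM ι M c (edge a b hab)) =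
      MSections.res (strZ ι) M (h.trans ((Zop_le_cover_inf ι _).trans (by rw [lo_edge, hi_edge]))) (c a b) := by
  rw [edgeValM_apply, MSections.res_res]
  have key : ∀ (i j : Fin (r + 1)) (ei : i = a) (ej : j = b) (h₁ : V ≤ cover ι i ⊓ cover ι j)
      (h₂ : V ≤ cover ι a ⊓ cover ι b), MSections.res (strZ ι) M h₁ (c i j) = MSections.res (strZ ι) M h₂ (c a b) := by
    intro i j ei ej; subst ei; subst ej; intro h₁ h₂; rfl
  exact key _ _ (lo_edge a b hab) (hi_edge a b hab) _ _

/-- **Cocycles go to cocycles**: for a Čech `1`-cocycle `c` of the tree, `dQM (edgeValM c) = 0`. [folklore] -/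
theorem dQM_edgeValM_eq_zero {c : CechMC1 (strZ ι) M (cover ι)} (hc : c ∈ cechMZ1 (strZ ι) M (cover ι)) :
    dQM ι M 1 (edgeValM ι M c) = 0 := by
  funext τ
  obtain ⟨a, b, e, hab, hbe, rfl⟩ := exists_eq_triangle τ
  rw [dQM_triangle]
  change _ = (0 : MSections (strZ ι) M (Zop ι (triangle a b e hab hbe).1))
  rw [res_edgeValM_edge, res_edgeValM_edge, res_edgeValM_edge]
  have h3 : Zop ι (triangle a b e hab hbe).1 ≤ cover ι a ⊓ cover ι b ⊓ cover ι e :=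
    le_inf (le_inf (Zop_mono ι (by simp [triangle, Finset.subset_iff]))
      (Zop_mono ι (by simp [triangle, Finset.subset_iff]))) (Zop_mono ι (by simp [triangle, Finset.subset_iff]))
  have key := congr_arg (MSections.res (strZ ι) M h3)
    (congr_fun (congr_fun (congr_fun ((mem_cechMZ1_iff _ _ _ c).mp hc) a) b) e)
  rw [Pi.zero_apply, Pi.zero_apply, Pi.zero_apply, map_zero, cechMD1_apply, map_add, map_sub, MSections.res_res,
    MSections.res_res, MSections.res_res] at key
  rw [← key]

/-- The `0`-cochain of `cechZM` attached to a `0`-cochain of the tree. [folklore] -/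
def vertexValM : CechMC0 (strZ ι) M (cover ι) →ₗ[A] QXM ι M 0 :=
  LinearMap.pi fun σ => MSections.res (strZ ι) M
    (Zop_mono ι (Finset.singleton_subset_iff.mpr (Finset.min'_mem σ.1 σ.2.1))) ∘ₗ
      LinearMap.proj (R := A) (φ := fun i => MSections (strZ ι) M (cover ι i)) (σ.1.min' σ.2.1)

/-- `vertexValM` at a vertex `{i}`, restricted. [folklore] -/
theorem res_vertexValM_vertex (g : CechMC0 (strZ ι) M (cover ι)) (i : Fin (r + 1)) {V : Z.Opens}
    (h : V ≤ Zop ι (vertex i).1) :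
    MSections.res (strZ ι) M h (vertexValM ι M g (vertex i)) = MSections.res (strZ ι) M h (g i) := by
  change MSections.res (strZ ι) M h (MSections.res (strZ ι) M _ (g ((vertex i).1.min' (vertex i).2.1))) = _
  rw [MSections.res_res]
  have key : ∀ (j : Fin (r + 1)) (ej : j = i) (h₁ : V ≤ cover ι j),
      MSections.res (strZ ι) M h₁ (g j) = MSections.res (strZ ι) M h (g i) := by
    intro j ej; subst ej; intro h₁; rfl
  exact key _ (by change ({i} : Finset (Fin (r + 1))).min' _ = i; rw [Finset.min'_singleton]) _

/-- **Coboundaries go to coboundaries**: `edgeValM (d⁰ g) = dQM (vertexValM g)`. [folklore] -/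
theorem edgeValM_cechMD0 (g : CechMC0 (strZ ι) M (cover ι)) :
    edgeValM ι M (cechMD0 (strZ ι) M (cover ι) g) = dQM ι M 0 (vertexValM ι M g) := by
  funext σ
  obtain ⟨a, b, hab, rfl⟩ := exists_eq_edge σ
  rw [dQM_edge, res_vertexValM_vertex, res_vertexValM_vertex]
  have := res_edgeValM_edge ι M (cechMD0 (strZ ι) M (cover ι) g) a b hab le_rfl
  rw [MSections.res_self] at this
  rw [this, cechMD0_apply, map_sub, MSections.res_res, MSections.res_res]
  rfl

/-! ## Cocycle identities and injectivity -/

/-- Restriction between opens which are equal (each contained in the other) is injective. [folklore] -/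
theorem resM_injective_of_le {V W : Z.Opens} (h : W ≤ V) (h' : V ≤ W) :
    Function.Injective (MSections.res (strZ ι) M h) := by
  obtain rfl : W = V := le_antisymm h h'
  intro a b hab
  rwa [MSections.res_self, MSections.res_self] at hab

/-- The diagonal values of a Čech `1`-cocycle (all ordered pairs) vanish: `c_{ii} = 0`. [folklore] -/
theorem cocycle_diagM {c : CechMC1 (strZ ι) M (cover ι)} (hc : c ∈ cechMZ1 (strZ ι) M (cover ι)) (i : Fin (r + 1)) :
    c i i = 0 := by
  have key := congr_fun (congr_fun (congr_fun ((mem_cechMZ1_iff _ _ _ c).mp hc) i) i) i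
  rw [cechMD1_apply, Pi.zero_apply, Pi.zero_apply, Pi.zero_apply,
    MSections.res_eq_res _ _ _ (inf_le_left : cover ι i ⊓ cover ι i ⊓ cover ι i ≤ cover ι i ⊓ cover ι i) (c i i),
    MSections.res_eq_res _ _ (le_inf (inf_le_left.trans inf_le_left) inf_le_right)
      (inf_le_left : cover ι i ⊓ cover ι i ⊓ cover ι i ≤ cover ι i ⊓ cover ι i) (c i i),
    sub_self, zero_add] at key
  exact resM_injective_of_le ι M inf_le_left (le_inf le_rfl inf_le_left) (by rw [key, map_zero])

/-- The values of a Čech `1`-cocycle (all ordered pairs) are antisymmetric, after restriction: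
`c_{ij}| + c_{ji}| = 0` on `Z_j ∩ Z_i ∩ Z_j`. [folklore] -/
theorem cocycle_antisymmM {c : CechMC1 (strZ ι) M (cover ι)} (hc : c ∈ cechMZ1 (strZ ι) M (cover ι)) (i j : Fin (r + 1)) :
    MSections.res (strZ ι) M (le_inf (inf_le_left.trans inf_le_right) inf_le_right) (c i j) +
      MSections.res (strZ ι) M (inf_le_left : cover ι j ⊓ cover ι i ⊓ cover ι j ≤ cover ι j ⊓ cover ι i) (c j i) = 0 := by
  have key := congr_fun (congr_fun (congr_fun ((mem_cechMZ1_iff _ _ _ c).mp hc) j) i) j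
  rw [cechMD1_apply, Pi.zero_apply, Pi.zero_apply, Pi.zero_apply, cocycle_diagM ι M hc j, map_zero, sub_zero] at key
  exact key

/-- **A cocycle whose edge values are alternating coboundaries is a coboundary of the tree**: if
`edgeValM c = dQM g'` then `c = d⁰ (i ↦ g'_{{i}})`. [folklore] -/
theorem mem_cechMB1_of_edgeValM_eq {c : CechMC1 (strZ ι) M (cover ι)} (hc : c ∈ cechMZ1 (strZ ι) M (cover ι))
    (g' : QXM ι M 0) (hg : dQM ι M 0 g' = edgeValM ι M c) : c ∈ cechMB1 (strZ ι) M (cover ι) := by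
  rw [mem_cechMB1_iff]
  refine ⟨fun i => g' (vertex i), ?_⟩
  -- the case `a < b`
  have hlt : ∀ a b (hab : a < b), cechMD0 (strZ ι) M (cover ι) (fun i => g' (vertex i)) a b = c a b := by
    intro a b hab
    have h2le : Zop ι ({a, b} : Finset (Fin (r + 1))) ≤ cover ι a ⊓ cover ι b :=
      le_inf (Zop_mono ι (by simp)) (Zop_mono ι (by simp))
    have hinj := resM_injective_of_le ι M (V := cover ι a ⊓ cover ι b) (W := Zop ι {a, b}) h2le
      (cover_inf_le_Zop_pair ι a b hab.ne)
    apply hinj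
    have h2 := res_edgeValM_edge ι M c a b hab le_rfl
    rw [MSections.res_self, ← hg, dQM_edge] at h2
    rw [cechMD0_apply, map_sub, MSections.res_res, MSections.res_res]
    exact h2
  funext a b
  rcases lt_trichotomy a b with hab | rfl | hab
  · exact hlt a b hab
  · rw [cocycle_diagM ι M hc a, cechMD0_apply]
    exact sub_eq_zero.mpr (MSections.res_eq_res _ _ _ _ _)
  · have hanti := cocycle_antisymmM ι M hc a b
    have hba := hlt b a hab
    apply resM_injective_of_le ι M (le_inf (inf_le_left.trans inf_le_right) inf_le_right :
      cover ι b ⊓ cover ι a ⊓ cover ι b ≤ cover ι a ⊓ cover ι b) (le_inf (le_inf inf_le_right inf_le_left) inf_le_right)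
    rw [eq_neg_of_add_eq_zero_left hanti, ← hba, cechMD0_apply, cechMD0_apply, map_sub, map_sub, MSections.res_res,
      MSections.res_res, MSections.res_res, MSections.res_res, neg_sub]

/-! ## Serre's vanishing theorem for `Ȟ¹(𝒰; G(n))` -/

omit ι M in
/-- A zero object of `ModuleCat` has one element. [folklore] -/
theorem subsingleton_of_isZero {N : ModuleCat.{u} A} (h : IsZero N) : Subsingleton N := by
  refine ⟨fun x y => ?_⟩
  have e : (𝟙 N : N ⟶ N) = 0 := h.eq_of_src _ _
  have hx : x = 0 := by simpa using congrArg (fun f : N ⟶ N => f.hom x) e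
  have hy : y = 0 := by simpa using congrArg (fun f : N ⟶ N => f.hom y) e
  rw [hx, hy]

variable (G : Z.Modules) {J : Type} [Fintype J] (m₀ : ℕ) (g : J → Γ(twistMod ι G m₀, ⊤)) [IsClosedImmersion ι]

/-- **`H¹` of `cechZM` vanishes concretely**: if `H¹(Č(𝒰; G(n))) = 0` then every `1`-cocycle of the
alternating complex is a coboundary. [folklore] -/
theorem exists_dQM_eq_of_isZero_homology (hgen : Generates ι G m₀ g) (n : ℕ)
    (hZ : IsZero ((cechZM ι G m₀ g hgen n).homology 1)) (x : QXM ι (twistMod ι G n) 1)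
    (hx : dQM ι (twistMod ι G n) 1 x = 0) : ∃ y : QXM ι (twistMod ι G n) 0, dQM ι (twistMod ι G n) 0 y = x := by
  set C := cechZM ι G m₀ g hgen n with hC
  have e : C.homology 1 ≅ (C.sc' 0 1 2).moduleCatLeftHomologyData.H :=
    C.homologyIsoSc' 0 1 2 (by simp) (by simp) ≪≫ (C.sc' 0 1 2).moduleCatHomologyIso
  have hZ' : IsZero (C.sc' 0 1 2).moduleCatLeftHomologyData.H := hZ.of_iso e.symm
  rw [ShortComplex.moduleCatLeftHomologyData_H] at hZ'
  haveI := subsingleton_of_isZero hZ'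
  have hf : (C.sc' 0 1 2).f = ModuleCat.ofHom (dQM ι (twistMod ι G n) 0) := cechZM_d ι G m₀ g hgen n 0
  have hg' : (C.sc' 0 1 2).g = ModuleCat.ofHom (dQM ι (twistMod ι G n) 1) := cechZM_d ι G m₀ g hgen n 1
  have hxker : x ∈ LinearMap.ker (C.sc' 0 1 2).g.hom := by
    change (C.sc' 0 1 2).g.hom x = 0
    rw [hg']
    exact hx
  have h0 : (Submodule.Quotient.mk ⟨x, hxker⟩ :
      LinearMap.ker (C.sc' 0 1 2).g.hom ⧸ LinearMap.range (C.sc' 0 1 2).moduleCatToCycles) = 0 :=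
    Subsingleton.elim _ _
  rw [Submodule.Quotient.mk_eq_zero] at h0
  obtain ⟨y, hy⟩ := h0
  refine ⟨y, ?_⟩
  have h1 := congr_arg Subtype.val hy
  change (C.sc' 0 1 2).f.hom y = x at h1
  rw [hf] at h1
  exact h1

/-- **Serre's vanishing theorem for `Ȟ¹` of the twists.** For a closed subscheme `ι : Z ↪ 𝐏ʳ_A` over a
Noetherian ring `A`, an affine-localizing `𝒪_Z`-module `G` and global sections `g_j ∈ Γ(Z, G(m₀))` whose
chart values generate `G` on each `Z_s` (Serre's theorem A), there is `d₀` such that the Čech cohomology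
`Ȟ¹(𝒰; G(n))` on the cover `𝒰 = (Z ∩ D₊(x_i))_i` vanishes for all `n ≥ d₀`.
[cite: Hartshorne1977, III Thm. 5.2 (b) p. 228 (PDF p. 284)] -/
theorem exists_forall_subsingleton_cechMH1_twistMod [IsNoetherianRing A] (hG : IsAffineLocalizing G)
    (hgen : Generates ι G m₀ g) :
    ∃ d₀ : ℕ, ∀ n : ℕ, d₀ ≤ n → Subsingleton (CechMH1 (strZ ι) (twistMod ι G n) (cover ι)) := by
  obtain ⟨d₀, hd₀⟩ := exists_forall_isZero_homology_cechZM ι G m₀ g hG hgen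
  refine ⟨d₀, fun n hn => ⟨fun a b => ?_⟩⟩
  obtain ⟨ca, rfl⟩ := CechMH1.mk_surjective _ _ _ a
  obtain ⟨cb, rfl⟩ := CechMH1.mk_surjective _ _ _ b
  rw [CechMH1.mk_eq_mk_iff]
  have hc : (ca : CechMC1 (strZ ι) (twistMod ι G n) (cover ι)) - cb ∈ cechMZ1 (strZ ι) (twistMod ι G n) (cover ι) :=
    Submodule.sub_mem _ ca.2 cb.2
  obtain ⟨y, hy⟩ := exists_dQM_eq_of_isZero_homology ι G m₀ g hgen n (hd₀ n hn 1 le_rfl)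
    (edgeValM ι (twistMod ι G n) ((ca : CechMC1 (strZ ι) (twistMod ι G n) (cover ι)) - cb))
    (dQM_edgeValM_eq_zero ι _ hc)
  exact mem_cechMB1_of_edgeValM_eq ι _ hc y hy

end SerreTwist

end Literature.AlgebraicGeometry.Modules

end
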